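import Mathlib
import Literature.Computability.AlgebraicComplexity.DepthThreeVariableReductionProofs

/-!
# The heavy-top hypothesis of R2 `HeavyTopLaw` fails for `m ≤ n − 8√n − 9` (census lemma, Negative lane)

Negative lane of crux `GrenetZeon.DualUnipotentThreeHalves` (item `stmt-ValiantsHypothesis-24318`), line `radical_split`
(`Cruxes/DualUnipotentThreeHalves/Lines/radical_split.lean`, tree sha16 `d8efaa181b34180f`).  Nothing here is a theorem about
the crux, S3b, R1 or R2; VP ≠ VNP is not touched.  R2 `HeavyTopLaw` asks flag-cheapness only of pencils `N` satisfying the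
HEAVY-TOP HYPOTHESIS `H(N) : ∀ K, RadOrth n m N K → dim K ≤ 16·m·⌊√n⌋ + 16·n`.  This file records, kernel-checked and
definition-free, reusing the landed `SaxenaSeshadhri.finsupp_eq_zero_or_single_of_degree_le_one` (the skeleton's `pencilAlg`, `linPart`, `RadOrth` appear UNFOLDED; the bridge
`example (N : AffMat n m) (hN : IsAffine N) (h : m + 8 * Nat.sqrt n + 9 ≤ n) : ¬ (∀ K, RadOrth n m N K → finrank K ≤ 16*m*Nat.sqrt n + 16*n)`
is checked by `rfl`-unfolding in scratch against verbatim copies of those definitions):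

* `eval_eq_coeff_zero_add_sum` — affine expansion `f(v) = f(0)-coefficient + Σ_c v_c · coeff_{e_c} f` for `totalDegree f ≤ 1`;
* `exists_topMap` — for an affine pencil the top `v ↦ N(v) − N(0)` is a LINEAR map `ℂ^{n×n} → M_m(ℂ)`;
* `not_heavyTop_of_mul_add_lt` — if `m·m + B < n·n` then NOT `∀ K, RadOrth(K) → dim K ≤ B`: the kernel `K₀` of the top map is
  trace-orthogonal to everything (its tops are `0`) and has `dim K₀ ≥ n² − m²`;
* `not_heavyTop_of_small` — the instance `B = 16·m·⌊√n⌋ + 16·n` under `m + 8·⌊√n⌋ + 9 ≤ n`.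

Reading: R2 is VACUOUSLY true at every `(n, m)` with `m ≤ n − 8√n − 9`; its content lives in `m ∈ [n − O(√n), n^{1.5}/√C₀]` and, more
sharply, on pencils whose top space has dimension `δ ≥ n² − 16m⌊√n⌋ − 16n` (replace `m·m` by `δ = rank` of the top map in
`not_heavyTop_of_mul_add_lt`; stated here with the cruder `δ ≤ m²`).  [folklore; statement of this development]
-/

set_option linter.dupNamespace false
set_option autoImplicit false

namespace Summit.ValiantsHypothesis.ValiantsHypothesis.Theorems.DualUnipotentThreeHalvesNegative.RadicalSplit

open MvPolynomial

/-- **Affine expansion.**  For `totalDegree f ≤ 1`: `f(v) = coeff₀ f + Σ_c v_c · coeff_{e_c} f`. -/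
theorem eval_eq_coeff_zero_add_sum {σ : Type*} [Fintype σ] (f : MvPolynomial σ ℂ) (hf : f.totalDegree ≤ 1)
    (v : σ → ℂ) : eval v f = coeff 0 f + ∑ c, v c * coeff (Finsupp.single c 1) f := by
  classical
  have hsupp : ∀ s ∈ f.support, s = 0 ∨ ∃ i, s = Finsupp.single i 1 := fun s hs =>
    Literature.Computability.AlgebraicComplexity.SaxenaSeshadhri.finsupp_eq_zero_or_single_of_degree_le_one s
      ((le_totalDegree hs).trans hf)
  rw [eval_eq]
  -- split the support sum into the constant term and the unit vectors
  have hsplit : ∑ d ∈ f.support, coeff d f * ∏ i ∈ d.support, v i ^ d i =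
      ∑ d ∈ f.support, (if d = 0 then coeff 0 f else 0) +
        ∑ d ∈ f.support, ∑ c, (if d = Finsupp.single c 1 then v c * coeff (Finsupp.single c 1) f else 0) := by
    rw [← Finset.sum_add_distrib]
    refine Finset.sum_congr rfl fun d hd => ?_
    rcases hsupp d hd with rfl | ⟨i, rfl⟩
    · rw [if_pos rfl, Finsupp.support_zero, Finset.prod_empty, mul_one,
        Finset.sum_eq_zero (fun c _ => if_neg (fun h => (Finsupp.single_ne_zero.mpr one_ne_zero) h.symm)),
        add_zero]
    · rw [if_neg (Finsupp.single_ne_zero.mpr one_ne_zero), zero_add,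
        Finset.sum_eq_single i (fun c _ hc => by
          rw [if_neg (fun h => hc ((Finsupp.single_left_injective one_ne_zero) h).symm)])
          (fun h => absurd (Finset.mem_univ i) h), if_pos rfl,
        Finsupp.support_single _ one_ne_zero, Finset.prod_singleton, Finsupp.single_eq_same, pow_one,
        mul_comm]
  rw [hsplit, Finset.sum_ite_eq' f.support (0 : σ →₀ ℕ) (fun _ => coeff 0 f)]
  congr 1
  · split_ifs with h
    · rfl
    · rw [eq_comm]; exact notMem_support_iff.mp h
  · rw [Finset.sum_comm]
    refine Finset.sum_congr rfl fun c _ => ?_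
    rw [Finset.sum_ite_eq' f.support (Finsupp.single c 1) (fun _ => v c * coeff (Finsupp.single c 1) f)]
    split_ifs with h
    · rfl
    · rw [notMem_support_iff.mp h, mul_zero]

/-- **The top of an affine pencil is a linear map** `v ↦ N(v) − N(0)`. -/
theorem exists_topMap {n m : ℕ} (N : Matrix (Fin m) (Fin m) (MvPolynomial (Fin n × Fin n) ℂ))
    (hN : ∀ i j, (N i j).totalDegree ≤ 1) :
    ∃ T : (Fin n × Fin n → ℂ) →ₗ[ℂ] Matrix (Fin m) (Fin m) ℂ,
      ∀ v, T v = N.map (MvPolynomial.eval v) - N.map (MvPolynomial.eval 0) := by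
  classical
  refine ⟨IsLinearMap.mk' (fun v => Matrix.of fun i j => ∑ c, v c * coeff (Finsupp.single c 1) (N i j))
    ⟨fun v w => ?_, fun a v => ?_⟩, fun v => ?_⟩
  · ext i j
    simp only [Matrix.of_apply, Matrix.add_apply, Pi.add_apply, add_mul, Finset.sum_add_distrib]
  · ext i j
    simp only [Matrix.of_apply, Matrix.smul_apply, Pi.smul_apply, smul_eq_mul, Finset.mul_sum, mul_assoc]
  · ext i j
    simp only [IsLinearMap.mk'_apply, Matrix.of_apply, Matrix.sub_apply, Matrix.map_apply]
    rw [eval_eq_coeff_zero_add_sum (N i j) (hN i j) v, eval_eq_coeff_zero_add_sum (N i j) (hN i j) 0]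
    simp

/-- **Small pencils are never heavy-top.**  If `m·m + B < n·n` then the heavy-top hypothesis with bound `B` fails: the kernel
of the top map is trace-orthogonal to the whole pencil algebra and has dimension `≥ n² − m² > B`.  (`RadOrth`, `linPart`,
`pencilAlg` of `radical_split.lean` unfolded.) -/
theorem not_heavyTop_of_mul_add_lt {n m : ℕ} (N : Matrix (Fin m) (Fin m) (MvPolynomial (Fin n × Fin n) ℂ))
    (hN : ∀ i j, (N i j).totalDegree ≤ 1) (B : ℕ) (hB : m * m + B < n * n) :
    ¬ (∀ K : Submodule ℂ (Fin n × Fin n → ℂ),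
        (∀ v ∈ K, ∀ b ∈ Algebra.adjoin ℂ (Set.range fun x : Fin n × Fin n → ℂ => N.map (MvPolynomial.eval x)),
          Matrix.trace ((N.map (MvPolynomial.eval v) - N.map (MvPolynomial.eval 0)) * b) = 0) →
        Module.finrank ℂ K ≤ B) := by
  intro h
  obtain ⟨T, hT⟩ := exists_topMap N hN
  have hK : Module.finrank ℂ (LinearMap.ker T) ≤ B := by
    refine h (LinearMap.ker T) ?_
    intro v hv b _
    rw [LinearMap.mem_ker] at hv
    rw [← hT v, hv, Matrix.zero_mul, Matrix.trace_zero]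
  have hrn := LinearMap.finrank_range_add_finrank_ker T
  have hV : Module.finrank ℂ (Fin n × Fin n → ℂ) = n * n := by
    simp [Module.finrank_fintype_fun_eq_card]
  have hrange : Module.finrank ℂ (LinearMap.range T) ≤ m * m := by
    have := Submodule.finrank_le (LinearMap.range T)
    simpa [Module.finrank_matrix] using this
  omega

/-- The numerical instance of R2: `m + 8·⌊√n⌋ + 9 ≤ n` forces `m² + 16·m·⌊√n⌋ + 16·n < n²`. -/
theorem sq_add_bound_lt_of_small (n m : ℕ) (h : m + 8 * Nat.sqrt n + 9 ≤ n) :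
    m * m + (16 * m * Nat.sqrt n + 16 * n) < n * n := by
  obtain ⟨t, ht⟩ : ∃ t, n = m + 8 * Nat.sqrt n + 9 + t := ⟨n - (m + 8 * Nat.sqrt n + 9), by omega⟩
  set l := Nat.sqrt n with hl
  have hl1 : 1 ≤ l := by
    rw [hl, Nat.le_sqrt]; omega
  rw [ht]
  nlinarith [hl1, Nat.zero_le t, Nat.zero_le m, Nat.zero_le (m * t), Nat.zero_le (l * l)]

/-- **R2 is vacuous for `m ≤ n − 8√n − 9`.**  For an affine pencil with `m + 8·⌊√n⌋ + 9 ≤ n` the heavy-top hypothesis of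
`HeavyTopLaw` (bound `16·m·⌊√n⌋ + 16·n`) is false, so R2 asserts nothing there. -/
theorem not_heavyTop_of_small {n m : ℕ} (N : Matrix (Fin m) (Fin m) (MvPolynomial (Fin n × Fin n) ℂ))
    (hN : ∀ i j, (N i j).totalDegree ≤ 1) (h : m + 8 * Nat.sqrt n + 9 ≤ n) :
    ¬ (∀ K : Submodule ℂ (Fin n × Fin n → ℂ),
        (∀ v ∈ K, ∀ b ∈ Algebra.adjoin ℂ (Set.range fun x : Fin n × Fin n → ℂ => N.map (MvPolynomial.eval x)),
          Matrix.trace ((N.map (MvPolynomial.eval v) - N.map (MvPolynomial.eval 0)) * b) = 0) →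
        Module.finrank ℂ K ≤ 16 * m * Nat.sqrt n + 16 * n) :=
  not_heavyTop_of_mul_add_lt N hN _ (sq_add_bound_lt_of_small n m h)

end Summit.ValiantsHypothesis.ValiantsHypothesis.Theorems.DualUnipotentThreeHalvesNegative.RadicalSplit
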